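import Mathlib.Tactic
import HarnessLib

/-!
# Kozma–Nitzan's Question 8 at three relays — the defect-correlation toolbox for the κ̂-sequence (gen 26)

Support file (`--supports stmt-CriticalPhenomena-4575`, closed crux; independent mathematics on Kozma–Nitzan's Question 8,
arXiv:2401.12397 §5.5 p. 36), prover `prim-ineq-gen-6` (gen 26).  No definitions, no named facts, no sorries; standard axioms.
Memo `run/shared/lean/prim/prim-ineq-gen-6/FINDING-G26.md` §3.

SETTING (memo vocabulary).  For a path-end block `T` with classes `k = 0..n−1`, weights `w_k = ω_k p_k ≥ 0` (`Σ w_k = P̄ ≤ 1`) and the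
CUMULATIVE marks `A_k = A_[0,k]`, `C_k = C_[0,k]` — both NON-INCREASING in `k` — the in-moments are `ε = Σ w_k A_k`, `π = Σ w_k C_k`,
`m = Σ w_k A_k C_k`, and `Φ = Σ w_k M(A_k,C_k) = ε + π − m`.  The depth-`j` quantity `κ̂_j` of the reduction identity (PROOF-THETA-G24 §4)
has the SYMMETRIC FORM `κ̂_j = a·u·L + γ·v·R − γ·a²·Φ·S·u·v` with `L, R ≥ 0` and channel weights `u, v ≥ 0` (memo THEOREM 2), so that
`κ̂_j < 0 ⟺ L/(γaΦSv) + R/(a²ΦSu) < 1` (`negChannel_normalised`).  The Chebyshev sum inequality on the CLASS INDEX with the co-monotone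
sequences `A_k, C_k` (`weighted_chebyshev_of_pairwise`, `sum_mul_sum_prod_ge`) gives `m·P̄ ≥ ε·π` — LEMMA W of gen 20 in one line and,
rewritten, `J·π ≥ (π−m)(P̄−π)` for the joint defect `J = Σ w_k(1−A_k)(1−C_k) ≤ 1 − Φ` — which turns `κ̂_j < 0` into explicit
SHALLOWNESS bounds (memo THEOREM 5; `amgm_exclusion`).  The conditional SSC step (memo THEOREM 6) is the planar lemma `triangle_step`.
[cite: KozmaNitzan2024, Question 8 (§5.5 p. 36)]
-/

namespace Summit.CriticalPhenomena.PercolationContinuityZ3.Theorems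

namespace PocketCert

open Finset

/-- **Weighted Chebyshev sum inequality (pairwise form).**  If `w ≥ 0` and `(f i − f j)(g i − g j) ≥ 0` for all `i, j`
(the sequences are similarly ordered), then `(Σ w f)(Σ w g) ≤ (Σ w)(Σ w f g)`.  Proof: the double sum
`Σ_i Σ_j w_i w_j (f_i − f_j)(g_i − g_j) ≥ 0` equals twice the difference. [cite: KozmaNitzan2024, Question 8 (§5.5 p. 36)] -/
theorem weighted_chebyshev_of_pairwise {ι : Type*} (s : Finset ι) (w f g : ι → ℝ) (hw : ∀ i ∈ s, 0 ≤ w i)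
    (hfg : ∀ i ∈ s, ∀ j ∈ s, 0 ≤ (f i - f j) * (g i - g j)) :
    (∑ i ∈ s, w i * f i) * (∑ i ∈ s, w i * g i) ≤ (∑ i ∈ s, w i) * (∑ i ∈ s, w i * (f i * g i)) := by
  have key : 0 ≤ ∑ i ∈ s, ∑ j ∈ s, w i * w j * ((f i - f j) * (g i - g j)) :=
    Finset.sum_nonneg fun i hi => Finset.sum_nonneg fun j hj =>
      mul_nonneg (mul_nonneg (hw i hi) (hw j hj)) (hfg i hi j hj)
  have expand : ∑ i ∈ s, ∑ j ∈ s, w i * w j * ((f i - f j) * (g i - g j))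
      = 2 * ((∑ i ∈ s, w i) * (∑ i ∈ s, w i * (f i * g i)) - (∑ i ∈ s, w i * f i) * (∑ i ∈ s, w i * g i)) := by
    have h1 : ∀ i ∈ s, ∑ j ∈ s, w i * w j * ((f i - f j) * (g i - g j))
        = w i * (f i * g i) * (∑ j ∈ s, w j) + w i * (∑ j ∈ s, w j * (f j * g j))
          - w i * f i * (∑ j ∈ s, w j * g j) - w i * g i * (∑ j ∈ s, w j * f j) := by
      intro i _
      rw [Finset.mul_sum, Finset.mul_sum, Finset.mul_sum, Finset.mul_sum, ← Finset.sum_add_distrib, ← Finset.sum_sub_distrib,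
        ← Finset.sum_sub_distrib]
      refine Finset.sum_congr rfl fun j _ => ?_
      ring
    rw [Finset.sum_congr rfl h1, Finset.sum_sub_distrib, Finset.sum_sub_distrib, Finset.sum_add_distrib,
      ← Finset.sum_mul, ← Finset.sum_mul, ← Finset.sum_mul, ← Finset.sum_mul]
    ring
  rw [expand] at key
  linarith

/-- **Co-monotone products dominate.**  For nonnegative weights `w` on a finite set of a linear order and two ANTITONE (non-increasing)
sequences `A, C` — the cumulative marks `A_[0,k], C_[0,k]` along the classes of a path-end block — one has
`(Σ w A)(Σ w C) ≤ (Σ w)(Σ w A C)`, i.e. `ε·π ≤ P̄·m` (LEMMA W `m ≥ πε` of gen 20 is the case `P̄ ≤ 1`).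
[cite: KozmaNitzan2024, Question 8 (§5.5 p. 36)] -/
theorem sum_mul_sum_prod_ge {ι : Type*} [LinearOrder ι] (s : Finset ι) (w A C : ι → ℝ) (hw : ∀ i ∈ s, 0 ≤ w i)
    (hA : AntitoneOn A s) (hC : AntitoneOn C s) :
    (∑ i ∈ s, w i * A i) * (∑ i ∈ s, w i * C i) ≤ (∑ i ∈ s, w i) * (∑ i ∈ s, w i * (A i * C i)) := by
  refine weighted_chebyshev_of_pairwise s w A C hw ?_
  intro i hi j hj
  rcases le_total i j with h | h
  · exact mul_nonneg (sub_nonneg.mpr (hA hi hj h)) (sub_nonneg.mpr (hC hi hj h))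
  · exact mul_nonneg_of_nonpos_of_nonpos (sub_nonpos.mpr (hA hj hi h)) (sub_nonpos.mpr (hC hj hi h))

/-- **The joint defect controls the product of the two one-sided defects.**  With `P̄ = Σ w`, `ε = Σ wA`, `π = Σ wC`, `m = Σ wAC`
and the joint defect `J := Σ w(1−A)(1−C) = P̄ − ε − π + m`, the Chebyshev inequality `επ ≤ P̄m` is EQUIVALENT to
`J·π ≥ (π − m)(P̄ − π)`: the A-defect `π − m = Σ wC(1−A)` times the C-defect `P̄ − π = Σ w(1−C)` is at most `J·π`.
[cite: KozmaNitzan2024, Question 8 (§5.5 p. 36)] -/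
theorem jointDefect_identity (Pbar ε π m : ℝ) :
    (Pbar - ε - π + m) * π - (π - m) * (Pbar - π) = Pbar * m - ε * π := by
  ring

/-- **Symmetric form of `κ̂_j` and the normalised negativity criterion.**  If `κ = a·u·L + γ·v·R − γ·a²·Φ·S·u·v` with
`a, γ, Φ, S, u, v > 0`, then `κ < 0` iff `L/(γ·a·Φ·S·v) + R/(a²·Φ·S·u) < 1`. [cite: KozmaNitzan2024, Question 8 (§5.5 p. 36)] -/
theorem negChannel_normalised (a γ Φ S u v L R : ℝ) (ha : 0 < a) (hγ : 0 < γ) (hΦ : 0 < Φ) (hS : 0 < S) (hu : 0 < u)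
    (hv : 0 < v) :
    a * u * L + γ * v * R - γ * a ^ 2 * Φ * S * u * v < 0 ↔
      L / (γ * a * Φ * S * v) + R / (a ^ 2 * Φ * S * u) < 1 := by
  have h1 : 0 < γ * a * Φ * S * v := by positivity
  have h2 : 0 < a ^ 2 * Φ * S * u := by positivity
  have h3 : 0 < γ * a ^ 2 * Φ * S * u * v := by positivity
  rw [div_add_div _ _ h1.ne' h2.ne', div_lt_one (by positivity)]
  constructor
  · intro h
    nlinarith [mul_pos h1 h2, mul_pos hu hv, mul_pos ha hγ]
  · intro h
    -- `L·(a²ΦSu) + R·(γaΦSv) < (γaΦSv)(a²ΦSu)`; divide by the common positive factor `a Φ S`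
    have h4 : 0 < a * Φ * S := by positivity
    nlinarith [mul_pos h1 h2, mul_pos hu hv, mul_pos ha hγ, mul_pos h4 hu, mul_pos h4 hv]

/-- **Lower bounds on the two normalised channels force shallowness (AM–GM exclusion).**  If `x + y < 1` with `x ≥ p/z` and
`y ≥ q·z` for some `z > 0` and `p, q ≥ 0` (memo: `x = 𝔄_j ≥ L_j/(ΦD)`, `y = 𝔅_j ≥ γ_j(Φ+m)D/(a_jΦπ)`, `z = D`), then `4pq < 1`;
contrapositively `4pq ≥ 1 ⟹ κ̂_j ≥ 0`. [cite: KozmaNitzan2024, Question 8 (§5.5 p. 36)] -/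
theorem amgm_exclusion (x y p q z : ℝ) (hz : 0 < z) (hp : 0 ≤ p) (hq : 0 ≤ q) (hx : p / z ≤ x) (hy : q * z ≤ y)
    (hxy : x + y < 1) : 4 * p * q < 1 := by
  have hpz : p ≤ x * z := by rwa [div_le_iff₀ hz] at hx
  have hx0 : 0 ≤ x := le_trans (div_nonneg hp hz.le) hx
  have hy0 : 0 ≤ y := le_trans (mul_nonneg hq hz.le) hy
  -- `p q ≤ (x z)(y/z)·… `: from `p ≤ x z` and `q z ≤ y` get `p q z ≤ x z · y`, i.e. `p q ≤ x y`
  have hpq : p * q ≤ x * y := by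
    have : p * (q * z) ≤ (x * z) * y := mul_le_mul hpz hy (mul_nonneg hq hz.le) (mul_nonneg hx0 hz.le)
    nlinarith
  nlinarith [sq_nonneg (x - y)]

/-- **The explicit shallowness bound.**  In the same situation the second channel alone gives `q·z < 1 − p/z ≤ 1`, hence `z < 1/q`
when `q > 0` (memo: `D < a_jΦπ/(γ_j(Φ+m))` whenever `κ̂_j < 0`). [cite: KozmaNitzan2024, Question 8 (§5.5 p. 36)] -/
theorem channel_bound_of_neg (x y p q z : ℝ) (hz : 0 < z) (hp : 0 ≤ p) (hq : 0 < q) (hx : p / z ≤ x) (hy : q * z ≤ y)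
    (hxy : x + y < 1) : z < 1 / q := by
  have hx0 : 0 ≤ x := le_trans (div_nonneg hp hz.le) hx
  rw [lt_div_iff₀ hq]
  nlinarith

/-- **The planar lemma behind the conditional SSC(κ̂) step (memo THEOREM 6).**  Let `x' + y' < 1` (`κ̂_{j+1} < 0`), `x' ≥ α`
(the absolute bound `𝔄_{j+1} ≥ L_{j+1}/(ΦD')`), and let the depth-`j` channels satisfy `x ≤ c·x'`, `y ≤ ρ·y'` with `c ≤ 1`
and `x', y' ≥ 0`.  If either `ρ ≤ 1`, or `ρ − 1 ≤ (ρ − c)·α`, then `x + y < 1` (`κ̂_j < 0`).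
[cite: KozmaNitzan2024, Question 8 (§5.5 p. 36)] -/
theorem triangle_step (x y x' y' c ρ α : ℝ) (hsum : x' + y' < 1) (hα : α ≤ x') (hx : x ≤ c * x') (hy : y ≤ ρ * y')
    (hc1 : c ≤ 1) (hy' : 0 ≤ y') (hx' : 0 ≤ x')
    (h : ρ ≤ 1 ∨ ρ - 1 ≤ (ρ - c) * α) : x + y < 1 := by
  rcases h with h | h
  · -- both contraction factors are at most one
    have : x + y ≤ c * x' + ρ * y' := by linarith
    nlinarith
  · -- `x + y ≤ c x' + ρ y' < c x' + ρ (1 − x') = ρ − (ρ − c) x' ≤ ρ − (ρ − c) α ≤ 1` when `ρ ≥ c`;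
    -- when `ρ < c ≤ 1` the first branch applies.
    rcases le_or_gt ρ 1 with hρ1 | hρ1
    · have : x + y ≤ c * x' + ρ * y' := by linarith
      nlinarith
    · have hρc : 0 ≤ ρ - c := by linarith
      have h1 : x + y < c * x' + ρ * (1 - x') := by nlinarith
      have h2 : c * x' + ρ * (1 - x') = ρ - (ρ - c) * x' := by ring
      have h3 : (ρ - c) * α ≤ (ρ - c) * x' := mul_le_mul_of_nonneg_left hα hρc
      linarith

end PocketCert

end Summit.CriticalPhenomena.PercolationContinuityZ3.Theorems
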